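import Mathlib
import Summits.MatrixMultiplication.MatrixMultiplication.Theorems.FidelityWitnessesFidelityThesisSepMajorantSingleProduct

/-!
# Line `separable-majorant` for crux `FidelityWitnesses.FidelityThesis` (stmt-MatrixMultiplication-4956) —
stub `stub_capBound`: the CAPTURE BOUND `cap ≤ ‖G‖_F ‖M‖_F ≤ √d · √(k k')`

Slots `b = (κ,μ)`, `c = (μ',ν)`, output `a₀ = (κ,ν)` in `Fin n × Fin n`.  Let `e₁, …, e_d` be a family of
vectors of `ℂ^{n×n} ⊗ ℂ^{n×n}` written in a pair family `a_i ⊗ b'_j` (`q = (i,j) ∈ Fin k × Fin k'`) with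
coefficients `γ_s`: `e_s(b,c) = Σ_q γ_s(q) a_{q.1}(b) b'_{q.2}(c)` (hypothesis `hγe`).  The CAPTURE of the family is
`cap := Σ_s Σ_{(κ,ν)} |Σ_m e_s((κ,m),(m,ν))|²` (`= tr(P_E W_n)` for an orthonormal `e`).  With the Gram matrix
`G_{qq'} := Σ_s γ_s(q) conj γ_s(q')` of the coefficient columns and the FLIP matrix
`M_{qq'} := Σ_{κ,ν,μ,μ'} a_{q.1}(κ,μ) b'_{q.2}(μ,ν) conj a_{q'.1}(κ,μ') conj b'_{q'.2}(μ',ν)` of the pair family,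
the exact identity

  `cap = Σ_{q,q'} G_{qq'} · M_{qq'}`       (`tr(P_E W) = ⟨G, M⟩`)

holds, so by Cauchy–Schwarz over the pair-of-pairs index `cap ≤ ‖G‖_F ‖M‖_F`; with `‖G‖_F² = d` (`hG`) and
`‖M‖_F² ≤ k k'` (`hM`) this is `cap ≤ √d · √(k k')` — the Cauchy–Schwarz heart of `M(n,r) ≤ r^{3/2}` in the
lead's `fidelity_le_rpow_threeHalves` (line card `Cruxes/FidelityThesis/Lines/Sketch.md`).  The identity: with
`P_q(κ,ν) := Σ_m a_{q.1}(κ,m) b'_{q.2}(m,ν)` one has `Σ_m e_s((κ,m),(m,ν)) = Σ_q γ_s(q) P_q(κ,ν)`, hence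
`cap = Σ_s Σ_x (Σ_q γ_s(q) P_q(x)) · conj(Σ_{q'} γ_s(q') P_{q'}(x)) = Σ_{q,q'} (Σ_s γ_s(q) conj γ_s(q')) (Σ_x P_q(x) conj P_{q'}(x))`
and `Σ_x P_q(x) conj P_{q'}(x) = M_{qq'}`.  Supports item `stmt-MatrixMultiplication-4956`; no definitions;
imports toolkit I only.
-/

namespace Summit.MatrixMultiplication.MatrixMultiplication.Theorems

open scoped BigOperators ComplexConjugate
open Literature.Computability.AlgebraicComplexity

/-- Expansion of a capture-type sum: for coefficient vectors `γ_s` and a family `P_q` of vectors of `ℂ^α`,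
`Σ_s Σ_x |Σ_q γ_s(q) P_q(x)|² = Σ_{q,q'} (Σ_s γ_s(q) conj γ_s(q')) · (Σ_x P_q(x) conj P_{q'}(x))` (as complex
numbers) — the Gram matrix of the coefficients paired with the Gram matrix of the family. [folklore] -/
theorem sepMajorantCB_normSq_expand {σ α ι : Type*} [Fintype σ] [Fintype α] [Fintype ι]
    (γ : σ → ι → ℂ) (P : ι → α → ℂ) :
    ((∑ s, ∑ x, ‖∑ q, γ s q * P q x‖ ^ 2 : ℝ) : ℂ) =
      ∑ q, ∑ q', (∑ s, γ s q * conj (γ s q')) * ∑ x, P q x * conj (P q' x) := by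
  -- `|z|² = z · conj z` (pattern of `DiagonalPowerDecay … sum_redPT_flip`)
  have hsq : ∀ z : ℂ, ((‖z‖ ^ 2 : ℝ) : ℂ) = z * conj z := fun z => by
    rw [Complex.mul_conj, Complex.normSq_eq_norm_sq, Complex.ofReal_pow]
  -- the four-fold reindexing `(s, x, q, q') ↦ (q, q', s, x)`
  have hcomm : ∀ F : σ → α → ι → ι → ℂ,
      ∑ s, ∑ x, ∑ q, ∑ q', F s x q q' = ∑ q, ∑ q', ∑ s, ∑ x, F s x q q' := by
    intro F
    calc ∑ s, ∑ x, ∑ q, ∑ q', F s x q q' = ∑ s, ∑ q, ∑ x, ∑ q', F s x q q' :=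
          Finset.sum_congr rfl fun s _ => Finset.sum_comm
      _ = ∑ q, ∑ s, ∑ x, ∑ q', F s x q q' := Finset.sum_comm
      _ = ∑ q, ∑ s, ∑ q', ∑ x, F s x q q' :=
          Finset.sum_congr rfl fun q _ => Finset.sum_congr rfl fun s _ => Finset.sum_comm
      _ = ∑ q, ∑ q', ∑ s, ∑ x, F s x q q' := Finset.sum_congr rfl fun q _ => Finset.sum_comm
  rw [Complex.ofReal_sum]
  calc ∑ s, ((∑ x, ‖∑ q, γ s q * P q x‖ ^ 2 : ℝ) : ℂ)
      = ∑ s, ∑ x, ∑ q, ∑ q', γ s q * conj (γ s q') * (P q x * conj (P q' x)) := by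
        refine Finset.sum_congr rfl fun s _ => ?_
        rw [Complex.ofReal_sum]
        refine Finset.sum_congr rfl fun x _ => ?_
        rw [hsq, map_sum, Finset.sum_mul_sum]
        refine Finset.sum_congr rfl fun q _ => Finset.sum_congr rfl fun q' _ => ?_
        rw [map_mul]
        ring
    _ = ∑ q, ∑ q', ∑ s, ∑ x, γ s q * conj (γ s q') * (P q x * conj (P q' x)) := hcomm _
    _ = ∑ q, ∑ q', (∑ s, γ s q * conj (γ s q')) * ∑ x, P q x * conj (P q' x) := by
        refine Finset.sum_congr rfl fun q _ => Finset.sum_congr rfl fun q' _ => ?_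
        rw [Fintype.sum_mul_sum]

/-- **Capture bound** (`cap ≤ ‖G‖_F ‖M‖_F ≤ √d · √(k k')`, the Cauchy–Schwarz heart of `M(n,r) ≤ r^{3/2}`).
For a family `e₁, …, e_d ∈ ℂ^{n×n} ⊗ ℂ^{n×n}` written in a pair family `a_i ⊗ b'_j` with coefficients `γ_s`
(`hγe`), whose coefficient Gram matrix `G_{qq'} = Σ_s γ_s(q) conj γ_s(q')` has Frobenius mass `d` (`hG`) and
whose flip matrix `M_{qq'} = Σ_{κ,ν,μ,μ'} a_{q.1}(κ,μ) b'_{q.2}(μ,ν) conj a_{q'.1}(κ,μ') conj b'_{q'.2}(μ',ν)` has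
Frobenius mass `≤ k k'` (`hM`), the capture `Σ_s Σ_{(κ,ν)} |Σ_m e_s((κ,m),(m,ν))|²` is at most `√d · √(k k')`:
it equals `Σ_{q,q'} G_{qq'} M_{qq'}` exactly, and Cauchy–Schwarz.  Line card
`Cruxes/FidelityThesis/Lines/Sketch.md` (capture step of `fidelity_le_rpow_threeHalves`). [folklore] -/
theorem stub_capBound {n d k k' : ℕ} (e : Fin d → Fin n × Fin n → Fin n × Fin n → ℂ)
    (a : Fin k → Fin n × Fin n → ℂ) (b' : Fin k' → Fin n × Fin n → ℂ) (γ : Fin d → Fin k × Fin k' → ℂ)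
    (hγe : ∀ (s : Fin d) (b c : Fin n × Fin n), e s b c = ∑ q, γ s q * (a q.1 b * b' q.2 c))
    (hG : ∑ q, ∑ q', ‖∑ s, γ s q * conj (γ s q')‖ ^ 2 = (d : ℝ))
    (hM : ∑ q : Fin k × Fin k', ∑ q' : Fin k × Fin k',
      ‖∑ κ : Fin n, ∑ ν : Fin n, ∑ μ : Fin n, ∑ μ' : Fin n,
        a q.1 (κ, μ) * b' q.2 (μ, ν) * conj (a q'.1 (κ, μ')) * conj (b' q'.2 (μ', ν))‖ ^ 2 ≤ (k : ℝ) * (k' : ℝ)) :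
    ∑ s, ∑ a₀ : Fin n × Fin n, ‖∑ m : Fin n, e s (a₀.1, m) (m, a₀.2)‖ ^ 2 ≤ Real.sqrt d * Real.sqrt ((k : ℝ) * (k' : ℝ)) := by
  -- the Gram matrix `G` of the coefficient columns and the flip matrix `M` of the pair family (opaque names)
  obtain ⟨G, hGdef⟩ : ∃ G : Fin k × Fin k' → Fin k × Fin k' → ℂ,
      ∀ q q', G q q' = ∑ s, γ s q * conj (γ s q') := ⟨_, fun _ _ => rfl⟩
  obtain ⟨M, hMdef⟩ : ∃ M : Fin k × Fin k' → Fin k × Fin k' → ℂ, ∀ q q', M q q' =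
      ∑ κ : Fin n, ∑ ν : Fin n, ∑ μ : Fin n, ∑ μ' : Fin n,
        a q.1 (κ, μ) * b' q.2 (μ, ν) * conj (a q'.1 (κ, μ')) * conj (b' q'.2 (μ', ν)) :=
    ⟨_, fun _ _ => rfl⟩
  -- the matrix-product entries `P_q(κ,ν) = (A_{q.1} B'_{q.2})_{κν}`
  obtain ⟨P, hPdef⟩ : ∃ P : Fin k × Fin k' → Fin n × Fin n → ℂ,
      ∀ q x, P q x = ∑ m : Fin n, a q.1 (x.1, m) * b' q.2 (m, x.2) := ⟨_, fun _ _ => rfl⟩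
  have hP2 : ∀ (q : Fin k × Fin k') (κ ν : Fin n), P q (κ, ν) = ∑ m : Fin n, a q.1 (κ, m) * b' q.2 (m, ν) :=
    fun q κ ν => hPdef q (κ, ν)
  have hG' : ∑ q, ∑ q', ‖G q q'‖ ^ 2 = (d : ℝ) := by simpa only [hGdef] using hG
  have hM' : ∑ q, ∑ q', ‖M q q'‖ ^ 2 ≤ (k : ℝ) * (k' : ℝ) := by simpa only [hMdef] using hM
  -- output slices of `e_s` in pair coordinates
  have hslice : ∀ (s : Fin d) (x : Fin n × Fin n),
      ∑ m : Fin n, e s (x.1, m) (m, x.2) = ∑ q, γ s q * P q x := by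
    intro s x
    calc ∑ m : Fin n, e s (x.1, m) (m, x.2)
        = ∑ m : Fin n, ∑ q, γ s q * (a q.1 (x.1, m) * b' q.2 (m, x.2)) :=
          Finset.sum_congr rfl fun m _ => hγe s _ _
      _ = ∑ q, ∑ m : Fin n, γ s q * (a q.1 (x.1, m) * b' q.2 (m, x.2)) := Finset.sum_comm
      _ = ∑ q, γ s q * P q x := by
          refine Finset.sum_congr rfl fun q _ => ?_
          rw [hPdef, Finset.mul_sum]
  -- the flip matrix is the Gram matrix of the `P_q`
  have hflip : ∀ q q' : Fin k × Fin k', ∑ x, P q x * conj (P q' x) = M q q' := by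
    intro q q'
    rw [hMdef, Fintype.sum_prod_type]
    refine Finset.sum_congr rfl fun κ _ => Finset.sum_congr rfl fun ν _ => ?_
    rw [hP2, hP2, map_sum, Finset.sum_mul_sum]
    refine Finset.sum_congr rfl fun μ _ => Finset.sum_congr rfl fun μ' _ => ?_
    rw [map_mul]
    ring
  -- THE IDENTITY `cap = Σ_{q,q'} G_{qq'} M_{qq'}` (as complex numbers)
  have hcap : ((∑ s, ∑ a₀ : Fin n × Fin n, ‖∑ m : Fin n, e s (a₀.1, m) (m, a₀.2)‖ ^ 2 : ℝ) : ℂ) =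
      ∑ q, ∑ q', G q q' * M q q' := by
    simp_rw [hslice]
    rw [sepMajorantCB_normSq_expand γ P]
    refine Finset.sum_congr rfl fun q _ => Finset.sum_congr rfl fun q' _ => ?_
    rw [hGdef, hflip]
  -- Cauchy–Schwarz over the pair-of-pairs index `(q, q')`
  have hCS : ‖∑ q, ∑ q', G q q' * M q q'‖ ^ 2 ≤ (d : ℝ) * ((k : ℝ) * (k' : ℝ)) := by
    have h : ‖∑ q, ∑ q', G q q' * M q q'‖ ^ 2 ≤ (∑ q, ∑ q', ‖G q q'‖ ^ 2) * ∑ q, ∑ q', ‖M q q'‖ ^ 2 := by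
      simpa only [Fintype.sum_prod_type] using
        sepMajorant_cauchySchwarz (fun p : (Fin k × Fin k') × (Fin k × Fin k') => G p.1 p.2)
          (fun p => M p.1 p.2)
    rw [hG'] at h
    exact h.trans (mul_le_mul_of_nonneg_left hM' (Nat.cast_nonneg d))
  -- conclude: `cap = ‖(cap : ℂ)‖`, `cap² ≤ d · (k k')`, `cap ≤ √(d · k k') = √d · √(k k')`
  have hnn : 0 ≤ ∑ s, ∑ a₀ : Fin n × Fin n, ‖∑ m : Fin n, e s (a₀.1, m) (m, a₀.2)‖ ^ 2 := by positivity
  have hsq : (∑ s, ∑ a₀ : Fin n × Fin n, ‖∑ m : Fin n, e s (a₀.1, m) (m, a₀.2)‖ ^ 2) ^ 2 ≤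
      (d : ℝ) * ((k : ℝ) * (k' : ℝ)) := by
    have hn : ‖((∑ s, ∑ a₀ : Fin n × Fin n, ‖∑ m : Fin n, e s (a₀.1, m) (m, a₀.2)‖ ^ 2 : ℝ) : ℂ)‖ =
        ∑ s, ∑ a₀ : Fin n × Fin n, ‖∑ m : Fin n, e s (a₀.1, m) (m, a₀.2)‖ ^ 2 :=
      Complex.norm_of_nonneg hnn
    rw [← hn, hcap]
    exact hCS
  calc ∑ s, ∑ a₀ : Fin n × Fin n, ‖∑ m : Fin n, e s (a₀.1, m) (m, a₀.2)‖ ^ 2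
      ≤ |∑ s, ∑ a₀ : Fin n × Fin n, ‖∑ m : Fin n, e s (a₀.1, m) (m, a₀.2)‖ ^ 2| := le_abs_self _
    _ ≤ Real.sqrt ((d : ℝ) * ((k : ℝ) * (k' : ℝ))) := Real.abs_le_sqrt hsq
    _ = Real.sqrt d * Real.sqrt ((k : ℝ) * (k' : ℝ)) := Real.sqrt_mul (Nat.cast_nonneg d) _

end Summit.MatrixMultiplication.MatrixMultiplication.Theorems
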